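import Summits.QuantumFields.YangMills.Theorems.BalabanUVNodesN12AtTheta13OfThm1CCMWCubeOfStubsSignFreeAllTorus
import Summits.QuantumFields.YangMills.Theorems.BalabanUVNodesN12AtRecord13OfResiduals
import Literature.MathematicalPhysics.QuantumFieldTheory.Balaban1983to89.Node00.N24ItemsStage13AtThm1CCMWOfStepRSignFreeAllTorusSepCoPH

/-!
# BalabanUVNodes ∕ N12 — THE K0⁷ → K1⁷ JUNCTION AT THE GENERIC DOOR OF RECORD (plan g81 K0⁷ V19; dag-n24-c's door letters): 12Zᴬ-AT `…N12AtTheta13OfThm1CCMWCubeOfStubsSignFreeAllTorus` §1–§2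
# RE-KEYED from V17's special door `θ₁₅ᶜᶜᴹᵂ(3;γ)(B₃, B₉B₃, a₀, min a₁ (a₀''∕B₃))` + stub-1∕2 letters to the GENERIC door-cured window-edition witness `θ₁₅ᶜᶜᴹᵂ(j;γ;ε₀,ε₂₉;B₃,B₃',a₀,a₁)` with EXACTLY the
# fifteen door letters of dag-n24-c's V19 closers (`hγ₀ hγh hε hε' hB hB' ha₀ ha₁ h15 hc h9 hbox hbox' hl hβ'`), N12 on the MIXED W-pin; and §3: dag-n24-c's PURE-pin N12 row `h12` ∕ the family `h12F`
# — its TYPE verbatim — from N12's five RAW per-run rows + the off-torus residual `hdeg`, reading NO door letter (Track A, DAG node N12 = [B15, Balaban1989LargeFieldI] CMP **122** (1989) 175–202;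
# cluster K1 — K1⁷ `StabilityBAtRecordR13SepCoPH` = stmt-QuantumFields-20542, helper; seat `pub-ymgap-dag-n12-d` g16 (R134 s2 «knit at the record»), 2026-08-28; count-neutral, CONDITIONAL, NOT a discharge)

HONEST FRAMING.  Count-neutral kernel COMPOSITION BY NAME.  WHY THIS FILE: plan g81 registered K0⁷ skeleton V19 (01:16Z 2026-08-28): stub 2′ = [6] Prop. 6 at NODE 00's PRINT-cube member (LANDED,
k0-s2-w1 p595104), stub 3ᴬ′ = the sign-free |β| box at the GENERIC cube letter `(j, c ≤ L^j)` with `B₃'` free; dag-n21-c PART 2 `K0PrintCubeOfStepTokensR.record13SepCoPHBody_of_stubs1_2P_3A'` composes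
K0⁷, and the K1⁷ closers of record became dag-n24-c's V19 Parts 23∕26∕27 (`…N24K1OfStubsV19ChildrenSplit{WorldBuilt,PSFloorWorldBuilt,RunRowsWorldBuilt}`, `…N24K1OfOpenStubsV19ChildrenSplitByName`),
which display every child lane as a family over the GENERIC door `θ₁₅ᶜᶜᴹᵂ(j;γ;ε₀,ε₂₉;B₃,B₃',a₀,a₁)` — NODE O's window `0 < γ ≤ ½`, `ε₀ ε₂₉ > 0`, `0 ≤ B₃`, `0 ≤ B₃'`, `0 < a₀`, `0 < a₁`, [15] Thm 1's regularity
sentence `VariationalThm1RegSepCoP7M F 2 B₃ a₀ a₁`, `c ≤ L^j`, the floor-carrying R (9)-step `Gauge9RegSepTopStepR F 2 suppDom (L^j) c B₃ B₃' a₀ a₁`, and the sign-free windowed box `bl ≤ β ≤ β'` on `]0,γ]`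
of the WINDOW EDITION's `betaOfRecord₁₃ F 2 θ₁₅ᶜᶜᴹᵂ(j;γ;…)` with `−bl·γ² ≤ 3`, `β'·γ² ≤ ¾` (Node00 `N24ItemsStage13AtThm1CCMWOfStepRSignFreeAllTorusSepCoPH.N24_provisos₁₃SepCoP_theta13OfThm1CCMW_of_gauge9TopStepR_of_betaBoxSignFree_allTorus`
= the v1.5 door provisos there).  This seat's 12Zᴬ-AT (p578356) keyed the same rung at V17's SPECIAL door `(j, B₃', a₁) := (3, B₉·B₃, min a₁ (a₀''∕B₃))` through stub 1∕2's letters and its own §0;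
§1∕§2 HERE are 12Zᴬ-AT §1∕§2 with the door letters swapped for dag-n24-c's and `hP :=` the Node00 door — proof terms otherwise VERBATIM (12T-H's door-cured S-bound socket ∕ 12V-H's cured ★★ at
`Θ := theta13OfNumerics … (stage12NumericsOfThm1CCMW F.L j γ ε₀ B₃ B₃' a₀ a₁) …`, whose ₁₃ live re-pin IS `θ₁₅ᶜᶜᴹᵂ(j;γ;…)` by `rfl`; K0b's residuals by K0a; admissibility by dag-n21-c A1ʷ's
`stage12NumericsOfThm1CCMW_pos_of_le_half`; term signs 12Y at `(N, j) := (2, j)`).  THE N12 SOCKET (why §1∕§2 are not redundant with Parts 23∕26): dag-n24-c's engine (`Node00/N24NodesStage13PinX3HSSepCoPH`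
:229) pins `W := WOfRecord₁₃ θ λW` at EVERY run and displays N12 as `h12 : ∀ P, B15Leaf (WOfRecord₁₃ F 2 θW λW P)` (+ `hsel`); every N12 producer of that leaf in the tree needs `λW.kSel P < P.K`
(12E `b15Leaf_WOfRecord₁₃_liveRepin₁₃_of_massLive_of_hasResiduals`, 12Iᵂ §1, …; def-T's step provisos `Record13` §4c are stated for `k < K`), so at runs with `P.K ≤ λW.kSel P` — every run
with `K = 0`, where `hsel` is void — the pure pin's conjunct has NO supplier; §1∕§2 keep this seat's MIXED pin (`θ.pinW W₀`, `hW : kSel P < K → W₀ P = WOfRecord₁₃ θ λW P`, `hWdeg : K ≤ kSel P →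
B15Leaf (W₀ P)`, `W₀ P :=` g4's degenerate leaf-carrier `exists_printedCarriers15_b15Leaf` off the torus — CHECKLIST §16.2), and §3 hands dag-n24-c's `h12` AND the family `h12F` (its TYPE
verbatim) from N12's five RAW rows below the torus + `hsel` + the residual `hdeg : ∀ P, K ≤ kSel P → B15Leaf (WOfRecord₁₃ θW λW P)`, reading NONE of the fifteen door letters (N12's leaf at the
bundle of record needs only K0b's residuals, carried by every `theta13OfNumerics`; 12E's `_all_` form).  WHICH CHILD BLOCKS (§1): the door letters (stub 1 → `h15` via dag-n07-e; stubs 1 ∧ 2′ →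
`hc h9` via PART 2; stub 3ᴬ′ → `hγ₀ hγh hbox hbox' hl hβ'` via Part 19 `windowLetters_of_absBetaBoxH` + dag-n21-c's `_of_half` transfers; `hε hε' hB hB' ha₀ ha₁` signs); the S-bound world
binding; rows h05S–h11 ∕ hUV; N12's layer `lamW` with `hsel`, the mixed pin `hW ∕ hWdeg`, and N12's per-run displays below the torus ((1.100) pin, live-mass — NODE 00 —, Prop. 1 — dag-n12-c ∕
12Q⁵ —, (1.80), (1.89) RAW — dag-n12-e's pins discharge them on the window road, companion file `…GenericDoorV19Window`).  Nothing of Bałaban's is asserted; every printed fact is a hypothesis; N12 is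
NOT discharged; no node is discharged; K0⁷ ∕ K1⁷ NOT closed; counts unmoved (discharged 5∕27 · Track A 5∕28).  ONE finite four-torus programme at fixed `ε = L^{-K}` — nothing continuum ∕ ℝ⁴ ∕ OS ∕
mass gap ∕ Clay.  No `sorry`, `def`, `instance`, `notation`.  v1.1 (same seat, same day): +§4 — the GUARDED («below the torus») form of §3's pair and family, `hdeg`-free, for
dag-n24-c's W₀-mixed-pin engine variant (its INTENT-39 «(A′)», this seat's ASK-1); §1–§3 byte-identical.  TYPING NOTE: `Stage13HParams.ofHistoryBlind F 2 (Stage13RParams.ofCured F 2 θW)` (this lineage) is dag-n24-c's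
`Stage13HParams.ofHistoryBlind F 2 ⟨θW, ZrOfRecord₁₃ F 2 θW⟩` by `Stage13RParams.ofCured`'s definition (FILE B′ `Record13SepCoPRInhabitedOfSepCoP` :102), and the two door proviso terms agree by
proof irrelevance — a consumer converts with `rfl`.

Sources: [Balaban1989LargeFieldI] (0.2)–(0.6) p.176, Prop. 1 (1.78) p.194, (1.80) p.195, (1.89) p.198, (1.99)–(1.102) pp.200–201; [Balaban1989LargeFieldII] Thm 1 + (0.1) pp.355–356, (1.4) p.357;
[Balaban1988Convergent] Thm 1 p.262, (2.4)–(2.12) pp.255–256, (2.13) p.257, (2.18) p.257, (3.16)–(3.25) pp.268–270; [Balaban1985Variational] Thm 1 (8)–(9) p.279, (144)–(152) pp.300–301, Prop. 8 p.304;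
[Balaban1985RegularSpaces] (1.3)–(1.9) p.77, Prop. 6 (1.135)–(1.138) p.99; [Balaban1987RG1] Thm 1 p.259, Thm 2 p.259, (0.20)–(0.21) p.256, (1.11)–(1.12) p.262, §1 (1.20)–(1.22) p.264.
-/

noncomputable section

open MeasureTheory
open scoped Matrix.Norms.L2Operator

namespace Summit.QuantumFields.YangMills.BalabanUVNodes.N12AtTheta13OfThm1CCMWGenericDoorV19

open Literature.MathematicalPhysics.QuantumFieldTheory.Balaban1983to89
open Literature.MathematicalPhysics.QuantumFieldTheory.Balaban1983to89.T4Continuum (T4Family)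
open Literature.MathematicalPhysics.QuantumFieldTheory.Balaban1983to89.DagBinding
open Literature.MathematicalPhysics.QuantumFieldTheory.Balaban1983to89.Node00
open FlowStep (BetaLowerH BetaUpperH)
open FlowStepRuns (genFlow)
open B15Claim189Assembly (new189 chiPP dom)
open B15 (Prop1Printed Ineq180)
open B15.BasicStep (Claim189)
open B8Eq17ClassAkV1 (plaqsOf)
open B15RPrime1100OfRep (rPrimeDataOfSel)
open Summit.QuantumFields.YangMills.BalabanUVNodes.N12AtTheta13OfThm1CCM (kappa_nonneg_theta13OfThm1CCM E0_nonneg_theta13OfThm1CCM B0_nonneg_theta13OfThm1CCM)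
open Summit.QuantumFields.YangMills.BalabanUVNodes.N12AtRecord13OfResiduals (b15Leaf_WOfRecord₁₃_liveRepin₁₃_all_of_massLive_of_hasResiduals)
open Summit.QuantumFields.YangMills.BalabanUVNodes.N12AtRecord13SepCoPHSockets (nodesAtSomeRecordS₁₃SepCoPH_of_upS_fourPinW₀_ofHistoryBlind_ofCured_liveRepin₁₃_of_massLive_of_hasResiduals)
open Summit.QuantumFields.YangMills.BalabanUVNodes.N12AtRecord13SepCoPHS (exists_guarded_recordS₁₃SepCoPH_b15_main_pinnedN12_ofHistoryBlind_ofCured_liveRepin₁₃_of_massLive_of_hasResiduals)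
open Summit.QuantumFields.YangMills.BalabanUVNodes.N12AtRecord13SepCoPHSocketsPinned (nodesAtSomeRecordS₁₃SepCoPH_of_upS_fourPinW₀_pinnedΛΩχZ_ofHistoryBlind_ofCured_liveRepin₁₃_of_massLive_of_hasResiduals)
open B15Claim189Assembly (Setting189 half)
open B15.PrelimIntegrations (Ineq191 Ineq195)
open B15Chi124DetSets (E124)
open B15DeterminingSets (MSField)
open B14DomainGeom (Pt)
open GaugeGroup (dist1)
open GaugeField (plaqHol)
open B15Claim189PrintedConditions (omegaOfChain)
open B15Claim189PinsOfHistory (sitOfHist N0OfRecord₁₃ D189OfHist)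
open B15Claim189LambdaPin (enlD)

variable {F : T4Family}

/-! ## §1 ★★★★ THE K1⁷ v5∕v6 RUNG-1 BODY AT THE DOOR-CURED GENERIC WINDOW-EDITION WITNESS FROM THE V19 DOOR LETTERS, N12 ON THE MIXED W-PIN (12T-H's cured socket ∘ the Node00 door) -/

section RungAtGenericDoor
variable {j c : ℕ} {γ ε₀ ε₂₉ B₃ B₃' a₀ a₁ : ℝ} (lamW : ResidW F 2)
  (Mstar : ℕ) (ops : OpsY 2 (theta13OfThm1CCMW F 2 j γ ε₀ ε₂₉ B₃ B₃' a₀ a₁).toStage3Params Mstar) (ζ : ResidZ F 2) (W₀ : B12.RunParams → PrintedCarriers15) (w : WorldP)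

/-- **★★★★ THE K0⁷ → K1⁷ JUNCTION AT THE GENERIC DOOR: THE v5∕v6 RUNG-1 BODY AT THE DOOR-CURED `θ₁₅ᶜᶜᴹᵂ(j;γ;ε₀,ε₂₉;B₃,B₃',a₀,a₁)` WITH ITS K-SIDE = dag-n24-c's FIFTEEN DOOR LETTERS, N12 ON THE
MIXED W-PIN** — 12Zᴬ-AT §1 (p578356) re-keyed: 12T-H's generic door-cured S-bound socket at `Θ := theta13OfNumerics … (stage12NumericsOfThm1CCMW F.L j γ ε₀ B₃ B₃' a₀ a₁) …` (whose ₁₃ live re-pin IS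
`θ₁₅ᶜᶜᴹᵂ(j;γ;…)` by `rfl`) with `hP :=` the Node00 door `N24_provisos₁₃SepCoP_theta13OfThm1CCMW_of_gauge9TopStepR_of_betaBoxSignFree_allTorus hγ₀ hγh hε hε' hB hB' ha₀ ha₁ h15 hc h9 hbox hbox' hl hβ'`
(dag-n24-c Part 14 §0; = K0a `provisos₁₃SepCoP_theta13LiveOfNumerics_of_bgSepCoP` ∘ dag-n21-c's all-torus Eʷ ∘ `hcompBoth_theta13OfThm1CCMW_of_betaBoxSignFree` ∘ B′), admissibility by A1ʷ's
`stage12NumericsOfThm1CCMW_pos_of_le_half`, term signs 12Y.  What the K1⁷ closer of `stub_nodes13PWS` needs from the K-side on V19's road is EXACTLY the door letters — NODE O's window `0 < γ ≤ ½`,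
`ε₀ ε₂₉ > 0`, the signs `0 ≤ B₃`, `0 ≤ B₃'`, `0 < a₀`, `0 < a₁`, [15] Thm 1's regularity sentence `h15` (⟸ stub 1's (8) top step, dag-n07-e `variationalThm1RegSepCoP7M_of_prop8TopStep`), the cube letter
`c ≤ L^j` and the floor-carrying R (9)-step `h9` (⟸ stubs 1 ∧ 2′, dag-n21-c PART 2 `gauge9Supplier_of_prop6MemberP`), the sign-free windowed box `bl ≤ β ≤ β'` on `]0,γ]` of the window edition's β with
`−bl·γ² ≤ 3`, `β'·γ² ≤ ¾` (⟸ stub 3ᴬ′ ∘ Part 19 `windowLetters_of_absBetaBoxH` ∘ dag-n21-c `betaLowerH∕betaUpperH_theta13OfThm1CCMW_of_half`) — and NOTHING ELSE; N12's §1 does NOT read the sign of β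
(the (1.80)∕(1.89) rows enter as RAW displays `h12i180`∕`h12c189`).  N12 (MIXED W-pin `hW`∕`hWdeg`, 12E — the satisfiable socket: off the torus `W₀ P` is the closer's leaf-carrier, NOT the bundle of
record) and N13 (dag-n11-e) resolved; the S-bound world binding `hC hγ hL hup` (`w.γ ≤ θ.γ = γ`), rows h05S–h11 ∕ hUV, N12's layer `lamW` with `hsel` and its per-run displays below the torus DISPLAYED.
The conclusion IS the body of the registered `NodesAtSomeRecord13PWS F` (K1⁷ v6 stub 1, byte-identical to v5; 12T-H certificate).  COMPOSITE and CONDITIONAL: nothing of Bałaban asserted, no node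
discharged, K0⁷ ∕ K1⁷ NOT closed; EVERY family `F` (all-torus door). [cite: Balaban1989LargeFieldII, Thm 1 p.355, (0.1) pp.355–356; Balaban1989LargeFieldI, (0.2)–(0.6) p.176, Prop. 1 (1.78) p.194, (1.80) p.195, (1.89) p.198, (1.99)–(1.102) pp.200–201; Balaban1988Convergent, Thm 1 p.262, (2.4)–(2.13) pp.255–257, (2.18) p.257, (3.16)–(3.25) pp.268–270; Balaban1985Variational, Thm 1 (8)–(9) p.279, (144)–(152) pp.300–301, Prop. 8 p.304; Balaban1985RegularSpaces, (1.3)–(1.9) p.77, Prop. 6 (1.135)–(1.138) p.99, Thm 8 (1.146) p.101; Balaban1985UV3, Thm 1 p.257, Thm 2 p.272; Balaban1985BackgroundPropagators, Thm 3.1 p.397; Balaban1987RG1, Thm 1 p.259, (0.20)–(0.21) p.256, (1.22) p.264, Lemma 4 p.280; Balaban1988RG2Cluster, Lemmas 1–3 pp.9–20 (bookkeeping)] -/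
theorem nodesAtSomeRecordS₁₃SepCoPH_of_upS_fourPinW₀_ofHistoryBlind_ofCured_theta13OfThm1CCMW_genericDoorV19_of_massLive
    -- THE GENERIC DOOR LETTERS (= dag-n24-c's `h05F … hUVF ∕ h12F` binder list, verbatim, = Node00 `N24_provisos₁₃SepCoP[H]_door…_of_gauge9TopStepR_of_betaBoxSignFree_allTorus`'s hypotheses
    -- at `N = 2`): NODE O's window `0 < γ ≤ ½`, the thresholds `ε₀ ε₂₉ > 0`, the signs `0 ≤ B₃`, `0 ≤ B₃'`, `0 < a₀`, `0 < a₁`, [15] Thm 1's regularity sentence (⟸ K0⁷ V19 stub 1's (8) top step,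
    -- dag-n07-e), the cube letter `c ≤ L^j` and the floor-carrying R (9)-step at `(L^j, c)` (⟸ stubs 1 ∧ 2′, dag-n21-c PART 2 `gauge9Supplier_of_prop6MemberP`), and the SIGN-FREE
    -- windowed β-box of the WINDOW EDITION's `β₁₃(θ₁₅ᶜᶜᴹᵂ(j;γ;…))` on `]0, γ]` with its two letters (⟸ stub 3ᴬ′ ∘ Part 19 `windowLetters_of_absBetaBoxH` ∘ dag-n21-c `betaLowerH∕betaUpperH_theta13OfThm1CCMW_of_half`)
    (hγ₀ : 0 < γ) (hγh : γ ≤ 1 / 2) (hε : 0 < ε₀) (hε' : 0 < ε₂₉) (hB : 0 ≤ B₃) (hB' : 0 ≤ B₃') (ha₀ : 0 < a₀) (ha₁ : 0 < a₁)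
    (h15 : VariationalThm1RegSepCoP7M F 2 B₃ a₀ a₁) (hc : c ≤ F.L ^ j)
    (h9 : Gauge9RegSepTopStepR F 2 (fun ν K Ω => suppDomOfRecord F ν K Ω) (F.L ^ j) c B₃ B₃' a₀ a₁)
    {bl β' : ℝ} (hbox : BetaLowerH bl γ (betaOfRecord₁₃ F 2 (theta13OfThm1CCMW F 2 j γ ε₀ ε₂₉ B₃ B₃' a₀ a₁)))
    (hbox' : BetaUpperH β' γ (betaOfRecord₁₃ F 2 (theta13OfThm1CCMW F 2 j γ ε₀ ε₂₉ B₃ B₃' a₀ a₁))) (hl : -bl * γ ^ 2 ≤ 3) (hβ' : β' * γ ^ 2 ≤ 3 / 4)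
    (hW : ∀ P : B12.RunParams, lamW.kSel P < P.K → W₀ P = WOfRecord₁₃ F 2 (theta13OfThm1CCMW F 2 j γ ε₀ ε₂₉ B₃ B₃' a₀ a₁) lamW P) (hWdeg : ∀ P : B12.RunParams, P.K ≤ lamW.kSel P → B15Leaf (W₀ P))
    (hC : w.C = (datumOfRecord₁₃SepCoPH F 2 (Stage13HParams.ofHistoryBlind F 2 (Stage13RParams.ofCured F 2 (theta13OfThm1CCMW F 2 j γ ε₀ ε₂₉ B₃ B₃' a₀ a₁))) (N24_provisos₁₃SepCoP_theta13OfThm1CCMW_of_gauge9TopStepR_of_betaBoxSignFree_allTorus hγ₀ hγh hε hε' hB hB' ha₀ ha₁ h15 hc h9 hbox hbox' hl hβ').ofCured.ofHistoryBlind).C) (hγ : 0 < w.γ ∧ w.γ ≤ (theta13OfThm1CCMW F 2 j γ ε₀ ε₂₉ B₃ B₃' a₀ a₁).γ) (hL : w.L = ((theta13OfThm1CCMW F 2 j γ ε₀ ε₂₉ B₃ B₃' a₀ a₁).L : ℝ))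
    (hup : ∀ P, w.up P = upOfRecord₅CS F 2 ((((((Stage13HParams.ofHistoryBlind F 2 (Stage13RParams.ofCured F 2 (theta13OfThm1CCMW F 2 j γ ε₀ ε₂₉ B₃ B₃' a₀ a₁))).toStage5₁₃CoPH F 2).pinB10 F 2).pinY F 2 (Y9OfRecord 2 (theta13OfThm1CCMW F 2 j γ ε₀ ε₂₉ B₃ B₃' a₀ a₁).toStage3Params Mstar ops)).pinZ F 2 (Z11OfRecord F 2 ζ)).pinW F 2 W₀) P)
    (h05S : ∀ P : B12.RunParams, (upOfRecord₅CS F 2 ((((((Stage13HParams.ofHistoryBlind F 2 (Stage13RParams.ofCured F 2 (theta13OfThm1CCMW F 2 j γ ε₀ ε₂₉ B₃ B₃' a₀ a₁))).toStage5₁₃CoPH F 2).pinB10 F 2).pinY F 2 (Y9OfRecord 2 (theta13OfThm1CCMW F 2 j γ ε₀ ε₂₉ B₃ B₃' a₀ a₁).toStage3Params Mstar ops)).pinZ F 2 (Z11OfRecord F 2 ζ)).pinW F 2 W₀) P).b8)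
    (h06 : B9LeafX (Y9OfRecord 2 (theta13OfThm1CCMW F 2 j γ ε₀ ε₂₉ B₃ B₃' a₀ a₁).toStage3Params Mstar ops))
    (h07 : B11Leaf (Z11OfRecord F 2 ζ))
    (h08 : PrintedUV3V 2 (theta13OfThm1CCMW F 2 j γ ε₀ ε₂₉ B₃ B₃' a₀ a₁).L)
    (h09 : ∀ P : B12.RunParams, B12Sec2to5.Lemma4Printed ((theta13OfThm1CCMW F 2 j γ ε₀ ε₂₉ B₃ B₃' a₀ a₁).res.X P).F12 ((theta13OfThm1CCMW F 2 j γ ε₀ ε₂₉ B₃ B₃' a₀ a₁).res.X P).c12)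
    (h09T : ∀ P : B12.RunParams, (leavesP w P).smallCouplings → (leavesP w P).smallFieldInductive)
    (h10 : ∀ P : B12.RunParams, B9LeafX (Y9OfRecord 2 (theta13OfThm1CCMW F 2 j γ ε₀ ε₂₉ B₃ B₃' a₀ a₁).toStage3Params Mstar ops) →
      (B10.Thm1PrintedCompact (((((((Stage13HParams.ofHistoryBlind F 2 (Stage13RParams.ofCured F 2 (theta13OfThm1CCMW F 2 j γ ε₀ ε₂₉ B₃ B₃' a₀ a₁))).toStage5₁₃CoPH F 2).pinB10 F 2).pinY F 2 (Y9OfRecord 2 (theta13OfThm1CCMW F 2 j γ ε₀ ε₂₉ B₃ B₃' a₀ a₁).toStage3Params Mstar ops)).pinZ F 2 (Z11OfRecord F 2 ζ)).pinW F 2 W₀).res.X P).runs10 ∧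
          B10.Thm2Printed (((((((Stage13HParams.ofHistoryBlind F 2 (Stage13RParams.ofCured F 2 (theta13OfThm1CCMW F 2 j γ ε₀ ε₂₉ B₃ B₃' a₀ a₁))).toStage5₁₃CoPH F 2).pinB10 F 2).pinY F 2 (Y9OfRecord 2 (theta13OfThm1CCMW F 2 j γ ε₀ ε₂₉ B₃ B₃' a₀ a₁).toStage3Params Mstar ops)).pinZ F 2 (Z11OfRecord F 2 ζ)).pinW F 2 W₀).res.X P).runs10) →
        B11Leaf (Z11OfRecord F 2 ζ) → B12Sec2to5.Lemma4Printed ((theta13OfThm1CCMW F 2 j γ ε₀ ε₂₉ B₃ B₃' a₀ a₁).res.X P).F12 ((theta13OfThm1CCMW F 2 j γ ε₀ ε₂₉ B₃ B₃' a₀ a₁).res.X P).c12 →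
          B13.Lemma1Printed ((theta13OfThm1CCMW F 2 j γ ε₀ ε₂₉ B₃ B₃' a₀ a₁).res.X P).S13 ((theta13OfThm1CCMW F 2 j γ ε₀ ε₂₉ B₃ B₃' a₀ a₁).res.X P).c13 ∧ B13.Lemma2Printed ((theta13OfThm1CCMW F 2 j γ ε₀ ε₂₉ B₃ B₃' a₀ a₁).res.X P).S13 ((theta13OfThm1CCMW F 2 j γ ε₀ ε₂₉ B₃ B₃' a₀ a₁).res.X P).c13 ∧
            B13.Lemma3Printed ((theta13OfThm1CCMW F 2 j γ ε₀ ε₂₉ B₃ B₃' a₀ a₁).res.X P).S13 ((theta13OfThm1CCMW F 2 j γ ε₀ ε₂₉ B₃ B₃' a₀ a₁).res.X P).c13)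
    (h11 : ∀ P : B12.RunParams, (leavesP w P).b7 → (leavesP w P).b8 → (leavesP w P).b9 → (leavesP w P).b10 → (leavesP w P).b11 →
      (leavesP w P).smallCouplings → (leavesP w P).smallFieldInductive → (leavesP w P).flowControl →
        ∀ k, k < P.K → SLaw₁₃CoPH F 2 (Stage13HParams.ofHistoryBlind F 2 (Stage13RParams.ofCured F 2 (theta13OfThm1CCMW F 2 j γ ε₀ ε₂₉ B₃ B₃' a₀ a₁))) P k → TLaw₁₃CoPH F 2 (Stage13HParams.ofHistoryBlind F 2 (Stage13RParams.ofCured F 2 (theta13OfThm1CCMW F 2 j γ ε₀ ε₂₉ B₃ B₃' a₀ a₁))) P k)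
    (hUV : ∀ P : B12.RunParams, (genFlow (betaOfRecord₁₃ F 2 (theta13OfThm1CCMW F 2 j γ ε₀ ε₂₉ B₃ B₃' a₀ a₁)) P.g0).InInterval w.γ P.K → ∀ k, k ≤ P.K → SLaw₁₃CoPH F 2 (Stage13HParams.ofHistoryBlind F 2 (Stage13RParams.ofCured F 2 (theta13OfThm1CCMW F 2 j γ ε₀ ε₂₉ B₃ B₃' a₀ a₁))) P k →
      ∀ U : GaugeField (F.P P.K) k (SU 2),
        chiβOfRecord₁₃ F 2 (theta13OfThm1CCMW F 2 j γ ε₀ ε₂₉ B₃ B₃' a₀ a₁) P.K (gOfRecord₁₃ F 2 (theta13OfThm1CCMW F 2 j γ ε₀ ε₂₉ B₃ B₃' a₀ a₁) P) k U *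
              Real.exp (-(1 / (gOfRecord₁₃ F 2 (theta13OfThm1CCMW F 2 j γ ε₀ ε₂₉ B₃ B₃' a₀ a₁) P k) ^ 2 * wilsonBGOfRecord F 2 (theta13OfThm1CCMW F 2 j γ ε₀ ε₂₉ B₃ B₃' a₀ a₁).εbg P k U)
                - w.em (gOfRecord₁₃ F 2 (theta13OfThm1CCMW F 2 j γ ε₀ ε₂₉ B₃ B₃' a₀ a₁) P k) * (Fintype.card (Site (F.P P.K) k) : ℝ)) ≤ densOfRecord₁₃ F 2 (theta13OfThm1CCMW F 2 j γ ε₀ ε₂₉ B₃ B₃' a₀ a₁) P k U ∧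
        densOfRecord₁₃ F 2 (theta13OfThm1CCMW F 2 j γ ε₀ ε₂₉ B₃ B₃' a₀ a₁) P k U ≤ Real.exp (w.ep (gOfRecord₁₃ F 2 (theta13OfThm1CCMW F 2 j γ ε₀ ε₂₉ B₃ B₃' a₀ a₁) P k) * (Fintype.card (Site (F.P P.K) k) : ℝ)))
    (h12pin : ∀ P : B12.RunParams, lamW.kSel P < P.K → lamW.D1100 P
      = rPrimeDataOfSel (reprTOfRecord₁₃ F 2 (theta13OfThm1CCMW F 2 j γ ε₀ ε₂₉ B₃ B₃' a₀ a₁) P (lamW.kSel P))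
          ((theta13OfThm1CCMW F 2 j γ ε₀ ε₂₉ B₃ B₃' a₀ a₁).ppSel P (gOfRecord₁₃ F 2 (theta13OfThm1CCMW F 2 j γ ε₀ ε₂₉ B₃ B₃' a₀ a₁) P) (lamW.kSel P + 1))
          (fibOfSeq F (theta13OfThm1CCMW F 2 j γ ε₀ ε₂₉ B₃ B₃' a₀ a₁).ν (theta13OfThm1CCMW F 2 j γ ε₀ ε₂₉ B₃ B₃' a₀ a₁).τ9 P (gOfRecord₁₃ F 2 (theta13OfThm1CCMW F 2 j γ ε₀ ε₂₉ B₃ B₃' a₀ a₁) P) (lamW.kSel P + 1)))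
    (h12mass : ∀ P : B12.RunParams, lamW.kSel P < P.K → ∀ s, LiveSeq F 2 (theta13OfThm1CCMW F 2 j γ ε₀ ε₂₉ B₃ B₃' a₀ a₁).ν (theta13OfThm1CCMW F 2 j γ ε₀ ε₂₉ B₃ B₃' a₀ a₁).τ9 P (gOfRecord₁₃ F 2 (theta13OfThm1CCMW F 2 j γ ε₀ ε₂₉ B₃ B₃' a₀ a₁) P) (lamW.kSel P + 1)
        (slotsTOfRecord F 2 (theta13OfThm1CCMW F 2 j γ ε₀ ε₂₉ B₃ B₃' a₀ a₁).ν (theta13OfThm1CCMW F 2 j γ ε₀ ε₂₉ B₃ B₃' a₀ a₁).τ9 (EOfRecord₁₃ F 2 (theta13OfThm1CCMW F 2 j γ ε₀ ε₂₉ B₃ B₃' a₀ a₁)) (wOfRecord₉ F 2 (theta13OfThm1CCMW F 2 j γ ε₀ ε₂₉ B₃ B₃' a₀ a₁).toStage9Params)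
          (theta13OfThm1CCMW F 2 j γ ε₀ ε₂₉ B₃ B₃' a₀ a₁).ppSel P (gOfRecord₁₃ F 2 (theta13OfThm1CCMW F 2 j γ ε₀ ε₂₉ B₃ B₃' a₀ a₁) P) (lamW.kSel P + 1)) s →
      0 < ∫ V, rterm (reprTOfRecord₁₃ F 2 (theta13OfThm1CCMW F 2 j γ ε₀ ε₂₉ B₃ B₃' a₀ a₁) P (lamW.kSel P)) s V ∂(fieldMeasure (F.P P.K) (lamW.kSel P + 1) (SU 2)))
    (h12P1 : ∀ P : B12.RunParams, lamW.kSel P < P.K → Prop1Printed (lamW.LF P))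
    (h12i180 : ∀ P : B12.RunParams, lamW.kSel P < P.K → ∀ U, new189 (lamW.D189 P) U → ∀ i, (lamW.D189 P).h ≤ i → i ≤ (lamW.D189 P).k →
      ∀ q ∈ plaqsOf (dom (lamW.D189 P) i),
        Ineq180 ((lamW.D189 P).dev0 U q) ((lamW.D189 P).ε (lamW.D189 P).k) (lamW.D189 P).η (lamW.D189 P).B₃ (lamW.D189 P).B₅ (lamW.D189 P).M (lamW.D189 P).δ
          ((lamW.D189 P).dist q) (lamW.D189 P).O1)
    (h12c189 : ∀ P : B12.RunParams, lamW.kSel P < P.K → Claim189 (new189 (lamW.D189 P)) (chiPP (lamW.D189 P)))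
    (hsel : ∀ P : B12.RunParams, 1 ≤ P.K → lamW.kSel P < P.K) :
    ∃ (θ' : Stage13HParams F 2) (h' : θ'.Provisos₁₃SepCoPH F 2) (w : WorldP), (θ'.ZhUnity F 2 ∧ θ'.SlotsNondegenerate₁₃ F 2) ∧ θ'.Admissible F 2 ∧
      (∃ (θ'' : Stage13HParams F 2) (h'' : θ''.Provisos₁₃SepCoPH F 2), θ''.Admissible F 2 ∧
        datumOfRecord₁₃SepCoPH F 2 θ' h' = datumOfRecord₁₃SepCoPH F 2 θ'' h'' ∧ w.C = (datumOfRecord₁₃SepCoPH F 2 θ' h').C ∧ (0 < w.γ ∧ w.γ ≤ θ''.γ) ∧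
        w.L = (θ''.L : ℝ) ∧ ∀ P : B12.RunParams, w.up P = upOfRecord₅CS F 2 (θ''.toStage5₁₃CoPH F 2) P) ∧
      (∀ P : B12.RunParams, Nodes (leavesP w P)) ∧ PrintedUV3V 2 θ'.L ∧
      ∃ lam : ResidW F 2, (∀ P : B12.RunParams, 1 ≤ P.K → lam.kSel P < P.K) ∧
        ∀ P : B12.RunParams, lam.kSel P < P.K → ((leavesP w P).rBasicStep ↔ B15Leaf (WOfRecord₁₃ F 2 θ'.toStage13Params lam P)) := by
  exact nodesAtSomeRecordS₁₃SepCoPH_of_upS_fourPinW₀_ofHistoryBlind_ofCured_liveRepin₁₃_of_massLive_of_hasResiduals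
    (theta13OfNumerics F 2 (stage12NumericsOfThm1CCMW F.L j γ ε₀ B₃ B₃' a₀ a₁) ε₂₉ (zeta316OfRecord F 2 (stage12NumericsOfThm1CCMW F.L j γ ε₀ B₃ B₃' a₀ a₁).ν (stage12NumericsOfThm1CCMW F.L j γ ε₀ B₃ B₃' a₀ a₁).τ9.M (stage12NumericsOfThm1CCMW F.L j γ ε₀ B₃ B₃' a₀ a₁).A₁) (RzOfRecord F 2) (ZtOfRecord F 2)) lamW Mstar ops ζ W₀ w
    (hasResidualsOfRecord_theta13OfNumerics F 2 (stage12NumericsOfThm1CCMW F.L j γ ε₀ B₃ B₃' a₀ a₁) ε₂₉)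
    (N24_provisos₁₃SepCoP_theta13OfThm1CCMW_of_gauge9TopStepR_of_betaBoxSignFree_allTorus hγ₀ hγh hε hε' hB hB' ha₀ ha₁ h15 hc h9 hbox hbox' hl hβ')
    (admissible_theta13OfNumerics F 2 (zeta316OfRecord F 2 (stage12NumericsOfThm1CCMW F.L j γ ε₀ B₃ B₃' a₀ a₁).ν (stage12NumericsOfThm1CCMW F.L j γ ε₀ B₃ B₃' a₀ a₁).τ9.M (stage12NumericsOfThm1CCMW F.L j γ ε₀ B₃ B₃' a₀ a₁).A₁) (RzOfRecord F 2) (ZtOfRecord F 2) (stage12NumericsOfThm1CCMW_pos_of_le_half F.hL.2.le hγ₀ hγh hε hB hB' ha₀ ha₁) hε')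
    (kappa_nonneg_theta13OfThm1CCM F 2 j ε₀ ε₂₉ B₃ B₃' a₀ a₁) (E0_nonneg_theta13OfThm1CCM F 2 j ε₀ ε₂₉ B₃ B₃' a₀ a₁) (B0_nonneg_theta13OfThm1CCM F 2 j ε₀ ε₂₉ B₃ B₃' a₀ a₁)
    hW hWdeg hC hγ hL hup h05S h06 h07 h08 h09 h09T h10 h11 hUV h12pin h12mass h12P1 h12i180 h12c189 hsel

end RungAtGenericDoor

/-! ## §2 ★★★★ THE RUNG RESTRICTED TO N12 AT THE GENERIC DOOR, SAME INPUTS (12V-H's cured ★★ ∘ the Node00 door) -/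

section N12RungAtGenericDoor
variable {j c : ℕ} {γ ε₀ ε₂₉ B₃ B₃' a₀ a₁ : ℝ} (lamW : ResidW F 2)

/-- **★★★★ THE RUNG RESTRICTED TO N12 AT THE DOOR-CURED GENERIC WITNESS FROM dag-n24-c's DOOR LETTERS** (12Zᴬ-AT §2 re-keyed; 12V-H's cured ★★ with `hP :=` the Node00 door): K-side = the fifteen door
letters; N12's layer `lamW`, `hsel` and per-run displays below the torus DISPLAYED (RAW (1.80)∕(1.89)); NO world, NO other child.  The N12 line of the which-child-blocks table ON V19's ROAD.  NOT the stub;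
CONDITIONAL; count-neutral. [cite: Balaban1989LargeFieldII, Thm 1 p.355, (0.1) pp.355–356; Balaban1989LargeFieldI, (0.2)–(0.6) p.176, Prop. 1 (1.78) p.194, (1.80) p.195, (1.89) p.198, (1.99)–(1.102) pp.200–201; Balaban1988Convergent, (2.10)–(2.12) p.256, (2.13) p.257, (3.16)–(3.25) pp.268–270; Balaban1985Variational, Thm 1 (8)–(9) p.279, (152) p.301, Prop. 8 p.304; Balaban1985RegularSpaces, (1.3)–(1.9) p.77, Prop. 6 p.99; Balaban1987RG1, Thm 1 p.259, (0.20)–(0.21) p.256, (1.22) p.264 (bookkeeping)] -/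
theorem exists_guarded_recordS₁₃SepCoPH_b15_main_pinnedN12_ofHistoryBlind_ofCured_theta13OfThm1CCMW_genericDoorV19_of_massLive
    -- THE GENERIC DOOR LETTERS (= dag-n24-c's `h05F … hUVF ∕ h12F` binder list, verbatim, = Node00 `N24_provisos₁₃SepCoP[H]_door…_of_gauge9TopStepR_of_betaBoxSignFree_allTorus`'s hypotheses
    -- at `N = 2`): NODE O's window `0 < γ ≤ ½`, the thresholds `ε₀ ε₂₉ > 0`, the signs `0 ≤ B₃`, `0 ≤ B₃'`, `0 < a₀`, `0 < a₁`, [15] Thm 1's regularity sentence (⟸ K0⁷ V19 stub 1's (8) top step,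
    -- dag-n07-e), the cube letter `c ≤ L^j` and the floor-carrying R (9)-step at `(L^j, c)` (⟸ stubs 1 ∧ 2′, dag-n21-c PART 2 `gauge9Supplier_of_prop6MemberP`), and the SIGN-FREE
    -- windowed β-box of the WINDOW EDITION's `β₁₃(θ₁₅ᶜᶜᴹᵂ(j;γ;…))` on `]0, γ]` with its two letters (⟸ stub 3ᴬ′ ∘ Part 19 `windowLetters_of_absBetaBoxH` ∘ dag-n21-c `betaLowerH∕betaUpperH_theta13OfThm1CCMW_of_half`)
    (hγ₀ : 0 < γ) (hγh : γ ≤ 1 / 2) (hε : 0 < ε₀) (hε' : 0 < ε₂₉) (hB : 0 ≤ B₃) (hB' : 0 ≤ B₃') (ha₀ : 0 < a₀) (ha₁ : 0 < a₁)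
    (h15 : VariationalThm1RegSepCoP7M F 2 B₃ a₀ a₁) (hc : c ≤ F.L ^ j)
    (h9 : Gauge9RegSepTopStepR F 2 (fun ν K Ω => suppDomOfRecord F ν K Ω) (F.L ^ j) c B₃ B₃' a₀ a₁)
    {bl β' : ℝ} (hbox : BetaLowerH bl γ (betaOfRecord₁₃ F 2 (theta13OfThm1CCMW F 2 j γ ε₀ ε₂₉ B₃ B₃' a₀ a₁)))
    (hbox' : BetaUpperH β' γ (betaOfRecord₁₃ F 2 (theta13OfThm1CCMW F 2 j γ ε₀ ε₂₉ B₃ B₃' a₀ a₁))) (hl : -bl * γ ^ 2 ≤ 3) (hβ' : β' * γ ^ 2 ≤ 3 / 4)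
    (h12pin : ∀ P : B12.RunParams, lamW.kSel P < P.K → lamW.D1100 P
      = rPrimeDataOfSel (reprTOfRecord₁₃ F 2 (theta13OfThm1CCMW F 2 j γ ε₀ ε₂₉ B₃ B₃' a₀ a₁) P (lamW.kSel P))
          ((theta13OfThm1CCMW F 2 j γ ε₀ ε₂₉ B₃ B₃' a₀ a₁).ppSel P (gOfRecord₁₃ F 2 (theta13OfThm1CCMW F 2 j γ ε₀ ε₂₉ B₃ B₃' a₀ a₁) P) (lamW.kSel P + 1))
          (fibOfSeq F (theta13OfThm1CCMW F 2 j γ ε₀ ε₂₉ B₃ B₃' a₀ a₁).ν (theta13OfThm1CCMW F 2 j γ ε₀ ε₂₉ B₃ B₃' a₀ a₁).τ9 P (gOfRecord₁₃ F 2 (theta13OfThm1CCMW F 2 j γ ε₀ ε₂₉ B₃ B₃' a₀ a₁) P) (lamW.kSel P + 1)))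
    (h12mass : ∀ P : B12.RunParams, lamW.kSel P < P.K → ∀ s, LiveSeq F 2 (theta13OfThm1CCMW F 2 j γ ε₀ ε₂₉ B₃ B₃' a₀ a₁).ν (theta13OfThm1CCMW F 2 j γ ε₀ ε₂₉ B₃ B₃' a₀ a₁).τ9 P (gOfRecord₁₃ F 2 (theta13OfThm1CCMW F 2 j γ ε₀ ε₂₉ B₃ B₃' a₀ a₁) P) (lamW.kSel P + 1)
        (slotsTOfRecord F 2 (theta13OfThm1CCMW F 2 j γ ε₀ ε₂₉ B₃ B₃' a₀ a₁).ν (theta13OfThm1CCMW F 2 j γ ε₀ ε₂₉ B₃ B₃' a₀ a₁).τ9 (EOfRecord₁₃ F 2 (theta13OfThm1CCMW F 2 j γ ε₀ ε₂₉ B₃ B₃' a₀ a₁)) (wOfRecord₉ F 2 (theta13OfThm1CCMW F 2 j γ ε₀ ε₂₉ B₃ B₃' a₀ a₁).toStage9Params)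
          (theta13OfThm1CCMW F 2 j γ ε₀ ε₂₉ B₃ B₃' a₀ a₁).ppSel P (gOfRecord₁₃ F 2 (theta13OfThm1CCMW F 2 j γ ε₀ ε₂₉ B₃ B₃' a₀ a₁) P) (lamW.kSel P + 1)) s →
      0 < ∫ V, rterm (reprTOfRecord₁₃ F 2 (theta13OfThm1CCMW F 2 j γ ε₀ ε₂₉ B₃ B₃' a₀ a₁) P (lamW.kSel P)) s V ∂(fieldMeasure (F.P P.K) (lamW.kSel P + 1) (SU 2)))
    (h12P1 : ∀ P : B12.RunParams, lamW.kSel P < P.K → Prop1Printed (lamW.LF P))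
    (h12i180 : ∀ P : B12.RunParams, lamW.kSel P < P.K → ∀ U, new189 (lamW.D189 P) U → ∀ i, (lamW.D189 P).h ≤ i → i ≤ (lamW.D189 P).k →
      ∀ q ∈ plaqsOf (dom (lamW.D189 P) i),
        Ineq180 ((lamW.D189 P).dev0 U q) ((lamW.D189 P).ε (lamW.D189 P).k) (lamW.D189 P).η (lamW.D189 P).B₃ (lamW.D189 P).B₅ (lamW.D189 P).M (lamW.D189 P).δ
          ((lamW.D189 P).dist q) (lamW.D189 P).O1)
    (h12c189 : ∀ P : B12.RunParams, lamW.kSel P < P.K → Claim189 (new189 (lamW.D189 P)) (chiPP (lamW.D189 P)))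
    (hsel : ∀ P : B12.RunParams, 1 ≤ P.K → lamW.kSel P < P.K) :
    ∃ (θ' : Stage13HParams F 2) (h' : θ'.Provisos₁₃SepCoPH F 2) (w : WorldP), (θ'.ZhUnity F 2 ∧ θ'.SlotsNondegenerate₁₃ F 2) ∧ θ'.Admissible F 2 ∧
      (∃ (θ'' : Stage13HParams F 2) (h'' : θ''.Provisos₁₃SepCoPH F 2), θ''.Admissible F 2 ∧
        datumOfRecord₁₃SepCoPH F 2 θ' h' = datumOfRecord₁₃SepCoPH F 2 θ'' h'' ∧ w.C = (datumOfRecord₁₃SepCoPH F 2 θ' h').C ∧ (0 < w.γ ∧ w.γ ≤ θ''.γ) ∧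
        w.L = (θ''.L : ℝ) ∧ ∀ P : B12.RunParams, w.up P = upOfRecord₅CS F 2 (θ''.toStage5₁₃CoPH F 2) P) ∧
      (∀ P : B12.RunParams, Dag.B15_main (leavesP w P)) ∧
      ∃ lam : ResidW F 2, (∀ P : B12.RunParams, 1 ≤ P.K → lam.kSel P < P.K) ∧
        ∀ P : B12.RunParams, lam.kSel P < P.K → ((leavesP w P).rBasicStep ↔ B15Leaf (WOfRecord₁₃ F 2 θ'.toStage13Params lam P)) := by
  exact exists_guarded_recordS₁₃SepCoPH_b15_main_pinnedN12_ofHistoryBlind_ofCured_liveRepin₁₃_of_massLive_of_hasResiduals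
    (theta13OfNumerics F 2 (stage12NumericsOfThm1CCMW F.L j γ ε₀ B₃ B₃' a₀ a₁) ε₂₉ (zeta316OfRecord F 2 (stage12NumericsOfThm1CCMW F.L j γ ε₀ B₃ B₃' a₀ a₁).ν (stage12NumericsOfThm1CCMW F.L j γ ε₀ B₃ B₃' a₀ a₁).τ9.M (stage12NumericsOfThm1CCMW F.L j γ ε₀ B₃ B₃' a₀ a₁).A₁) (RzOfRecord F 2) (ZtOfRecord F 2)) lamW
    (hasResidualsOfRecord_theta13OfNumerics F 2 (stage12NumericsOfThm1CCMW F.L j γ ε₀ B₃ B₃' a₀ a₁) ε₂₉)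
    (N24_provisos₁₃SepCoP_theta13OfThm1CCMW_of_gauge9TopStepR_of_betaBoxSignFree_allTorus hγ₀ hγh hε hε' hB hB' ha₀ ha₁ h15 hc h9 hbox hbox' hl hβ')
    (admissible_theta13OfNumerics F 2 (zeta316OfRecord F 2 (stage12NumericsOfThm1CCMW F.L j γ ε₀ B₃ B₃' a₀ a₁).ν (stage12NumericsOfThm1CCMW F.L j γ ε₀ B₃ B₃' a₀ a₁).τ9.M (stage12NumericsOfThm1CCMW F.L j γ ε₀ B₃ B₃' a₀ a₁).A₁) (RzOfRecord F 2) (ZtOfRecord F 2) (stage12NumericsOfThm1CCMW_pos_of_le_half F.hL.2.le hγ₀ hγh hε hB hB' ha₀ ha₁) hε')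
    h12pin h12mass h12P1 h12i180 h12c189 hsel

end N12RungAtGenericDoor

/-! ## §3 ★★ dag-n24-c's PURE four-pin N12 row `h12` ∕ `h12F` (V19 Parts 23∕26∕27) FROM N12's FIVE RAW PER-RUN ROWS BELOW THE TORUS + THE DEGENERATE-RUN RESIDUAL `hdeg` — DOOR-FREE -/

section PurePinRow
variable {j : ℕ} {γ ε₀ ε₂₉ B₃ B₃' a₀ a₁ : ℝ} (lamW : ResidW F 2)

/-- **★★ dag-n24-c's `h12` AT ONE GENERIC WITNESS `θ₁₅ᶜᶜᴹᵂ(j;γ;ε₀,ε₂₉;B₃,B₃',a₀,a₁)` FROM N12's RAW ROWS + `hdeg`, READING NO DOOR LETTER** — the pair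
`(∀ P, B15Leaf (WOfRecord₁₃ F 2 θW lamW P)) ∧ (∀ P, 1 ≤ P.K → lamW.kSel P < P.K)` that Parts 23 §1∕§2 (`h12`) and the engine `Node00/N24NodesStage13PinX3HSSepCoPH` :229 display for N12, at N12's
layer `lamW`, from: BELOW THE TORUS (`kSel P < K`) the (1.100) pin equation, live-mass (NODE 00), Proposition 1 (1.78) at `λ.LF P`, (1.80), (1.89) — RAW displays —, the selector bound `hsel`,
and OFF THE TORUS (`K ≤ kSel P`, in particular every run with `K = 0`, where `hsel` is void) the leaf ITSELF, `hdeg` — the residual of the PURE pin: no N12 producer in the tree serves those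
runs (every `…_of_massLive…` producer needs `kSel P < K`; def-T's step provisos are stated for `k < K`), whereas the MIXED pin of §1∕§2 (`hW`∕`hWdeg`, `W₀ P :=` a degenerate leaf-carrier off
the torus) needs no such row.  PROOF: 12E `b15Leaf_WOfRecord₁₃_liveRepin₁₃_all_of_massLive_of_hasResiduals` at `Θ := theta13OfNumerics … (stage12NumericsOfThm1CCMW F.L j γ …) …` (whose ₁₃ live
re-pin IS `θ₁₅ᶜᶜᴹᵂ(j;γ)`, `rfl`), K0b's residuals by K0a's `hasResidualsOfRecord_theta13OfNumerics` — NO window, NO box, NO (8)∕(9) token, NO proviso, NO admissibility: N12's leaf at the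
bundle of record reads only K0b's residuals, which EVERY member of the numerics family carries.  CONDITIONAL on the displayed rows; nothing of Bałaban asserted; N12 NOT discharged.
[cite: Balaban1989LargeFieldI, (0.2)–(0.6) p.176, p.176 ll.14–16, Prop. 1 (1.78) p.194, (1.80) p.195, (1.89) p.198, (1.99)–(1.102) pp.200–201; Balaban1988Convergent, (2.18) p.257, (3.16) p.268, (3.22)–(3.25) pp.269–270 (bookkeeping)] -/
theorem exists_residW_b15Leaf_all_theta13OfThm1CCMW_of_hdeg_of_massLive
    (hdeg : ∀ P : B12.RunParams, P.K ≤ lamW.kSel P → B15Leaf (WOfRecord₁₃ F 2 (theta13OfThm1CCMW F 2 j γ ε₀ ε₂₉ B₃ B₃' a₀ a₁) lamW P))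
    (h12pin : ∀ P : B12.RunParams, lamW.kSel P < P.K → lamW.D1100 P
      = rPrimeDataOfSel (reprTOfRecord₁₃ F 2 (theta13OfThm1CCMW F 2 j γ ε₀ ε₂₉ B₃ B₃' a₀ a₁) P (lamW.kSel P))
          ((theta13OfThm1CCMW F 2 j γ ε₀ ε₂₉ B₃ B₃' a₀ a₁).ppSel P (gOfRecord₁₃ F 2 (theta13OfThm1CCMW F 2 j γ ε₀ ε₂₉ B₃ B₃' a₀ a₁) P) (lamW.kSel P + 1))
          (fibOfSeq F (theta13OfThm1CCMW F 2 j γ ε₀ ε₂₉ B₃ B₃' a₀ a₁).ν (theta13OfThm1CCMW F 2 j γ ε₀ ε₂₉ B₃ B₃' a₀ a₁).τ9 P (gOfRecord₁₃ F 2 (theta13OfThm1CCMW F 2 j γ ε₀ ε₂₉ B₃ B₃' a₀ a₁) P) (lamW.kSel P + 1)))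
    (h12mass : ∀ P : B12.RunParams, lamW.kSel P < P.K → ∀ s, LiveSeq F 2 (theta13OfThm1CCMW F 2 j γ ε₀ ε₂₉ B₃ B₃' a₀ a₁).ν (theta13OfThm1CCMW F 2 j γ ε₀ ε₂₉ B₃ B₃' a₀ a₁).τ9 P (gOfRecord₁₃ F 2 (theta13OfThm1CCMW F 2 j γ ε₀ ε₂₉ B₃ B₃' a₀ a₁) P) (lamW.kSel P + 1)
        (slotsTOfRecord F 2 (theta13OfThm1CCMW F 2 j γ ε₀ ε₂₉ B₃ B₃' a₀ a₁).ν (theta13OfThm1CCMW F 2 j γ ε₀ ε₂₉ B₃ B₃' a₀ a₁).τ9 (EOfRecord₁₃ F 2 (theta13OfThm1CCMW F 2 j γ ε₀ ε₂₉ B₃ B₃' a₀ a₁)) (wOfRecord₉ F 2 (theta13OfThm1CCMW F 2 j γ ε₀ ε₂₉ B₃ B₃' a₀ a₁).toStage9Params)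
          (theta13OfThm1CCMW F 2 j γ ε₀ ε₂₉ B₃ B₃' a₀ a₁).ppSel P (gOfRecord₁₃ F 2 (theta13OfThm1CCMW F 2 j γ ε₀ ε₂₉ B₃ B₃' a₀ a₁) P) (lamW.kSel P + 1)) s →
      0 < ∫ V, rterm (reprTOfRecord₁₃ F 2 (theta13OfThm1CCMW F 2 j γ ε₀ ε₂₉ B₃ B₃' a₀ a₁) P (lamW.kSel P)) s V ∂(fieldMeasure (F.P P.K) (lamW.kSel P + 1) (SU 2)))
    (h12P1 : ∀ P : B12.RunParams, lamW.kSel P < P.K → Prop1Printed (lamW.LF P))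
    (h12i180 : ∀ P : B12.RunParams, lamW.kSel P < P.K → ∀ U, new189 (lamW.D189 P) U → ∀ i, (lamW.D189 P).h ≤ i → i ≤ (lamW.D189 P).k →
      ∀ q ∈ plaqsOf (dom (lamW.D189 P) i),
        Ineq180 ((lamW.D189 P).dev0 U q) ((lamW.D189 P).ε (lamW.D189 P).k) (lamW.D189 P).η (lamW.D189 P).B₃ (lamW.D189 P).B₅ (lamW.D189 P).M (lamW.D189 P).δ
          ((lamW.D189 P).dist q) (lamW.D189 P).O1)
    (h12c189 : ∀ P : B12.RunParams, lamW.kSel P < P.K → Claim189 (new189 (lamW.D189 P)) (chiPP (lamW.D189 P)))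
    (hsel : ∀ P : B12.RunParams, 1 ≤ P.K → lamW.kSel P < P.K) :
    ∃ lamW : ResidW F 2, (∀ P : B12.RunParams, B15Leaf (WOfRecord₁₃ F 2 (theta13OfThm1CCMW F 2 j γ ε₀ ε₂₉ B₃ B₃' a₀ a₁) lamW P)) ∧
      ∀ P : B12.RunParams, 1 ≤ P.K → lamW.kSel P < P.K :=
  ⟨lamW, b15Leaf_WOfRecord₁₃_liveRepin₁₃_all_of_massLive_of_hasResiduals (theta13OfNumerics F 2 (stage12NumericsOfThm1CCMW F.L j γ ε₀ B₃ B₃' a₀ a₁) ε₂₉ (zeta316OfRecord F 2 (stage12NumericsOfThm1CCMW F.L j γ ε₀ B₃ B₃' a₀ a₁).ν (stage12NumericsOfThm1CCMW F.L j γ ε₀ B₃ B₃' a₀ a₁).τ9.M (stage12NumericsOfThm1CCMW F.L j γ ε₀ B₃ B₃' a₀ a₁).A₁) (RzOfRecord F 2) (ZtOfRecord F 2)) lamW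
    (hasResidualsOfRecord_theta13OfNumerics F 2 (stage12NumericsOfThm1CCMW F.L j γ ε₀ B₃ B₃' a₀ a₁) ε₂₉) hdeg h12pin h12mass h12P1 h12i180 h12c189, hsel⟩

end PurePinRow

section PurePinFamily
variable (lamW : ∀ (j : ℕ) (γ ε₀ ε₂₉ B₃ B₃' a₀ a₁ : ℝ), ResidW F 2)

/-- **★★ dag-n24-c's FAMILY `h12F` (Parts 23 §3∕§4, 26, 27 — its TYPE verbatim, door letters and all) FROM N12's RAW ROWS + `hdeg` AS FAMILIES OVER THE WITNESS LETTERS ONLY** — one layer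
`lamW j γ ε₀ ε₂₉ B₃ B₃' a₀ a₁` per witness; the fifteen door letters `(hγ₀ hγh hε hε' hB hB' ha₀ ha₁ h15 hc h9 hbox hbox' hl hβ')` of the family are NOT READ (N12's leaf needs none of them —
the window, the box and the (8)∕(9) tokens serve the PROVISOS of the K1 world, not N12's bundle).  So «what N12 owes the K1⁷ closer of record on V19's road» in the closer's own currency is:
per witness, the five raw rows below the torus + `hsel` + the pure pin's off-torus residual `hdeg`.  CONDITIONAL; nothing of Bałaban asserted; N12 NOT discharged; K0⁷ ∕ K1⁷ NOT closed.
[cite: Balaban1989LargeFieldI, (0.2)–(0.6) p.176, Prop. 1 (1.78) p.194, (1.80) p.195, (1.89) p.198, (1.99)–(1.102) pp.200–201; Balaban1988Convergent, (2.18) p.257, (3.16) p.268, (3.22)–(3.25) pp.269–270; Balaban1985Variational, Thm 1 (8)–(9) p.279; Balaban1987RG1, Thm 1 p.259, §1 p.264 (bookkeeping: the unread door letters)] -/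
theorem h12F_theta13OfThm1CCMW_of_hdeg_of_massLive
    (hdegF : ∀ (j : ℕ) (γ ε₀ ε₂₉ B₃ B₃' a₀ a₁ : ℝ), ∀ P : B12.RunParams, P.K ≤ (lamW j γ ε₀ ε₂₉ B₃ B₃' a₀ a₁).kSel P → B15Leaf (WOfRecord₁₃ F 2 (theta13OfThm1CCMW F 2 j γ ε₀ ε₂₉ B₃ B₃' a₀ a₁) (lamW j γ ε₀ ε₂₉ B₃ B₃' a₀ a₁) P))
    (h12pinF : ∀ (j : ℕ) (γ ε₀ ε₂₉ B₃ B₃' a₀ a₁ : ℝ), ∀ P : B12.RunParams, (lamW j γ ε₀ ε₂₉ B₃ B₃' a₀ a₁).kSel P < P.K → (lamW j γ ε₀ ε₂₉ B₃ B₃' a₀ a₁).D1100 P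
      = rPrimeDataOfSel (reprTOfRecord₁₃ F 2 (theta13OfThm1CCMW F 2 j γ ε₀ ε₂₉ B₃ B₃' a₀ a₁) P ((lamW j γ ε₀ ε₂₉ B₃ B₃' a₀ a₁).kSel P))
          ((theta13OfThm1CCMW F 2 j γ ε₀ ε₂₉ B₃ B₃' a₀ a₁).ppSel P (gOfRecord₁₃ F 2 (theta13OfThm1CCMW F 2 j γ ε₀ ε₂₉ B₃ B₃' a₀ a₁) P) ((lamW j γ ε₀ ε₂₉ B₃ B₃' a₀ a₁).kSel P + 1))
          (fibOfSeq F (theta13OfThm1CCMW F 2 j γ ε₀ ε₂₉ B₃ B₃' a₀ a₁).ν (theta13OfThm1CCMW F 2 j γ ε₀ ε₂₉ B₃ B₃' a₀ a₁).τ9 P (gOfRecord₁₃ F 2 (theta13OfThm1CCMW F 2 j γ ε₀ ε₂₉ B₃ B₃' a₀ a₁) P) ((lamW j γ ε₀ ε₂₉ B₃ B₃' a₀ a₁).kSel P + 1)))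
    (h12massF : ∀ (j : ℕ) (γ ε₀ ε₂₉ B₃ B₃' a₀ a₁ : ℝ), ∀ P : B12.RunParams, (lamW j γ ε₀ ε₂₉ B₃ B₃' a₀ a₁).kSel P < P.K → ∀ s, LiveSeq F 2 (theta13OfThm1CCMW F 2 j γ ε₀ ε₂₉ B₃ B₃' a₀ a₁).ν (theta13OfThm1CCMW F 2 j γ ε₀ ε₂₉ B₃ B₃' a₀ a₁).τ9 P (gOfRecord₁₃ F 2 (theta13OfThm1CCMW F 2 j γ ε₀ ε₂₉ B₃ B₃' a₀ a₁) P) ((lamW j γ ε₀ ε₂₉ B₃ B₃' a₀ a₁).kSel P + 1)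
        (slotsTOfRecord F 2 (theta13OfThm1CCMW F 2 j γ ε₀ ε₂₉ B₃ B₃' a₀ a₁).ν (theta13OfThm1CCMW F 2 j γ ε₀ ε₂₉ B₃ B₃' a₀ a₁).τ9 (EOfRecord₁₃ F 2 (theta13OfThm1CCMW F 2 j γ ε₀ ε₂₉ B₃ B₃' a₀ a₁)) (wOfRecord₉ F 2 (theta13OfThm1CCMW F 2 j γ ε₀ ε₂₉ B₃ B₃' a₀ a₁).toStage9Params)
          (theta13OfThm1CCMW F 2 j γ ε₀ ε₂₉ B₃ B₃' a₀ a₁).ppSel P (gOfRecord₁₃ F 2 (theta13OfThm1CCMW F 2 j γ ε₀ ε₂₉ B₃ B₃' a₀ a₁) P) ((lamW j γ ε₀ ε₂₉ B₃ B₃' a₀ a₁).kSel P + 1)) s →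
      0 < ∫ V, rterm (reprTOfRecord₁₃ F 2 (theta13OfThm1CCMW F 2 j γ ε₀ ε₂₉ B₃ B₃' a₀ a₁) P ((lamW j γ ε₀ ε₂₉ B₃ B₃' a₀ a₁).kSel P)) s V ∂(fieldMeasure (F.P P.K) ((lamW j γ ε₀ ε₂₉ B₃ B₃' a₀ a₁).kSel P + 1) (SU 2)))
    (h12P1F : ∀ (j : ℕ) (γ ε₀ ε₂₉ B₃ B₃' a₀ a₁ : ℝ), ∀ P : B12.RunParams, (lamW j γ ε₀ ε₂₉ B₃ B₃' a₀ a₁).kSel P < P.K → Prop1Printed ((lamW j γ ε₀ ε₂₉ B₃ B₃' a₀ a₁).LF P))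
    (h12i180F : ∀ (j : ℕ) (γ ε₀ ε₂₉ B₃ B₃' a₀ a₁ : ℝ), ∀ P : B12.RunParams, (lamW j γ ε₀ ε₂₉ B₃ B₃' a₀ a₁).kSel P < P.K → ∀ U, new189 ((lamW j γ ε₀ ε₂₉ B₃ B₃' a₀ a₁).D189 P) U → ∀ i, ((lamW j γ ε₀ ε₂₉ B₃ B₃' a₀ a₁).D189 P).h ≤ i → i ≤ ((lamW j γ ε₀ ε₂₉ B₃ B₃' a₀ a₁).D189 P).k →
      ∀ q ∈ plaqsOf (dom ((lamW j γ ε₀ ε₂₉ B₃ B₃' a₀ a₁).D189 P) i),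
        Ineq180 (((lamW j γ ε₀ ε₂₉ B₃ B₃' a₀ a₁).D189 P).dev0 U q) (((lamW j γ ε₀ ε₂₉ B₃ B₃' a₀ a₁).D189 P).ε ((lamW j γ ε₀ ε₂₉ B₃ B₃' a₀ a₁).D189 P).k) ((lamW j γ ε₀ ε₂₉ B₃ B₃' a₀ a₁).D189 P).η ((lamW j γ ε₀ ε₂₉ B₃ B₃' a₀ a₁).D189 P).B₃ ((lamW j γ ε₀ ε₂₉ B₃ B₃' a₀ a₁).D189 P).B₅ ((lamW j γ ε₀ ε₂₉ B₃ B₃' a₀ a₁).D189 P).M ((lamW j γ ε₀ ε₂₉ B₃ B₃' a₀ a₁).D189 P).δ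
          (((lamW j γ ε₀ ε₂₉ B₃ B₃' a₀ a₁).D189 P).dist q) ((lamW j γ ε₀ ε₂₉ B₃ B₃' a₀ a₁).D189 P).O1)
    (h12c189F : ∀ (j : ℕ) (γ ε₀ ε₂₉ B₃ B₃' a₀ a₁ : ℝ), ∀ P : B12.RunParams, (lamW j γ ε₀ ε₂₉ B₃ B₃' a₀ a₁).kSel P < P.K → Claim189 (new189 ((lamW j γ ε₀ ε₂₉ B₃ B₃' a₀ a₁).D189 P)) (chiPP ((lamW j γ ε₀ ε₂₉ B₃ B₃' a₀ a₁).D189 P)))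
    (hselF : ∀ (j : ℕ) (γ ε₀ ε₂₉ B₃ B₃' a₀ a₁ : ℝ), ∀ P : B12.RunParams, 1 ≤ P.K → (lamW j γ ε₀ ε₂₉ B₃ B₃' a₀ a₁).kSel P < P.K) :
    ∀ {j c : ℕ} {γ ε₀ ε₂₉ B₃ B₃' a₀ a₁ : ℝ} (hγ₀ : 0 < γ) (hγh : γ ≤ 1 / 2) (hε : 0 < ε₀) (hε' : 0 < ε₂₉) (hB : 0 ≤ B₃) (hB' : 0 ≤ B₃') (ha₀ : 0 < a₀) (ha₁ : 0 < a₁) (h15 : VariationalThm1RegSepCoP7M F 2 B₃ a₀ a₁) (hc : c ≤ F.L ^ j) (h9 : Gauge9RegSepTopStepR F 2 (fun ν K Ω => suppDomOfRecord F ν K Ω) (F.L ^ j) c B₃ B₃' a₀ a₁) {bl β' : ℝ} (hbox : BetaLowerH bl γ (betaOfRecord₁₃ F 2 (theta13OfThm1CCMW F 2 j γ ε₀ ε₂₉ B₃ B₃' a₀ a₁))) (hbox' : BetaUpperH β' γ (betaOfRecord₁₃ F 2 (theta13OfThm1CCMW F 2 j γ ε₀ ε₂₉ B₃ B₃' a₀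 a₁))) (hl : -bl * γ ^ 2 ≤ 3) (hβ' : β' * γ ^ 2 ≤ 3 / 4),
      ∃ lamW : ResidW F 2, (∀ P : B12.RunParams, B15Leaf (WOfRecord₁₃ F 2 (theta13OfThm1CCMW F 2 j γ ε₀ ε₂₉ B₃ B₃' a₀ a₁) lamW P)) ∧
      ∀ P : B12.RunParams, 1 ≤ P.K → lamW.kSel P < P.K :=
  by
  intro j _ γ ε₀ ε₂₉ B₃ B₃' a₀ a₁ _ _ _ _ _ _ _ _ _ _ _ _ _ _ _ _ _
  exact exists_residW_b15Leaf_all_theta13OfThm1CCMW_of_hdeg_of_massLive (lamW j γ ε₀ ε₂₉ B₃ B₃' a₀ a₁) (hdegF j γ ε₀ ε₂₉ B₃ B₃' a₀ a₁)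
      (h12pinF j γ ε₀ ε₂₉ B₃ B₃' a₀ a₁) (h12massF j γ ε₀ ε₂₉ B₃ B₃' a₀ a₁) (h12P1F j γ ε₀ ε₂₉ B₃ B₃' a₀ a₁) (h12i180F j γ ε₀ ε₂₉ B₃ B₃' a₀ a₁)
      (h12c189F j γ ε₀ ε₂₉ B₃ B₃' a₀ a₁) (hselF j γ ε₀ ε₂₉ B₃ B₃' a₀ a₁)

end PurePinFamily

/-! ## §4 (v1.1) THE GUARDED («BELOW THE TORUS») FORM OF dag-n24-c's PURE-PIN ROW — FOR ITS W₀-MIXED-PIN ENGINE VARIANT (bus ASK-1 2026-08-28): `hdeg`-FREE, DOOR-FREE -/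

section PurePinRowBelow
open Summit.QuantumFields.YangMills.BalabanUVNodes.N12AtRecord13OfResiduals (b15Leaf_WOfRecord₁₃_liveRepin₁₃_of_massLive_of_hasResiduals)
variable {j : ℕ} {γ ε₀ ε₂₉ B₃ B₃' a₀ a₁ : ℝ} (lamW : ResidW F 2)

/-- **★★ THE GUARDED PAIR AT ONE GENERIC WITNESS `θ₁₅ᶜᶜᴹᵂ(j;γ;ε₀,ε₂₉;B₃,B₃',a₀,a₁)` FROM N12's RAW ROWS ALONE** — `(∀ P, lamW.kSel P < P.K → B15Leaf (WOfRecord₁₃ F 2 θW lamW P)) ∧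
(∀ P, 1 ≤ P.K → lamW.kSel P < P.K)`: §3's pair with the first conjunct read BELOW THE TORUS only — the shape dag-n24-c's W₀-mixed-pin engine variant (its INTENT-39 «(A′) if you ask»; this
seat's ASK-1) displays for N12 once the world carries `W₀ P :=` the bundle of record below the torus and g4's degenerate leaf-carrier `N12AtRecord12Pointed.exists_printedCarriers15_b15Leaf`
off it (`hWdeg` a theorem there).  NO `hdeg`, NO door letter: the five raw per-run rows + `hsel`, by 12E `b15Leaf_WOfRecord₁₃_liveRepin₁₃_of_massLive_of_hasResiduals` at
`Θ := theta13OfNumerics … (stage12NumericsOfThm1CCMW F.L j γ …) …` (K0b's residuals by K0a).  CONDITIONAL on the displayed rows; nothing of Bałaban asserted; N12 NOT discharged.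
[cite: Balaban1989LargeFieldI, (0.2)–(0.6) p.176, p.176 ll.14–16, Prop. 1 (1.78) p.194, (1.80) p.195, (1.89) p.198, (1.99)–(1.102) pp.200–201; Balaban1988Convergent, (2.18) p.257, (3.16) p.268, (3.22)–(3.25) pp.269–270 (bookkeeping)] -/
theorem exists_residW_b15Leaf_below_theta13OfThm1CCMW_of_massLive
    (h12pin : ∀ P : B12.RunParams, lamW.kSel P < P.K → lamW.D1100 P
      = rPrimeDataOfSel (reprTOfRecord₁₃ F 2 (theta13OfThm1CCMW F 2 j γ ε₀ ε₂₉ B₃ B₃' a₀ a₁) P (lamW.kSel P))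
          ((theta13OfThm1CCMW F 2 j γ ε₀ ε₂₉ B₃ B₃' a₀ a₁).ppSel P (gOfRecord₁₃ F 2 (theta13OfThm1CCMW F 2 j γ ε₀ ε₂₉ B₃ B₃' a₀ a₁) P) (lamW.kSel P + 1))
          (fibOfSeq F (theta13OfThm1CCMW F 2 j γ ε₀ ε₂₉ B₃ B₃' a₀ a₁).ν (theta13OfThm1CCMW F 2 j γ ε₀ ε₂₉ B₃ B₃' a₀ a₁).τ9 P (gOfRecord₁₃ F 2 (theta13OfThm1CCMW F 2 j γ ε₀ ε₂₉ B₃ B₃' a₀ a₁) P) (lamW.kSel P + 1)))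
    (h12mass : ∀ P : B12.RunParams, lamW.kSel P < P.K → ∀ s, LiveSeq F 2 (theta13OfThm1CCMW F 2 j γ ε₀ ε₂₉ B₃ B₃' a₀ a₁).ν (theta13OfThm1CCMW F 2 j γ ε₀ ε₂₉ B₃ B₃' a₀ a₁).τ9 P (gOfRecord₁₃ F 2 (theta13OfThm1CCMW F 2 j γ ε₀ ε₂₉ B₃ B₃' a₀ a₁) P) (lamW.kSel P + 1)
        (slotsTOfRecord F 2 (theta13OfThm1CCMW F 2 j γ ε₀ ε₂₉ B₃ B₃' a₀ a₁).ν (theta13OfThm1CCMW F 2 j γ ε₀ ε₂₉ B₃ B₃' a₀ a₁).τ9 (EOfRecord₁₃ F 2 (theta13OfThm1CCMW F 2 j γ ε₀ ε₂₉ B₃ B₃' a₀ a₁)) (wOfRecord₉ F 2 (theta13OfThm1CCMW F 2 j γ ε₀ ε₂₉ B₃ B₃' a₀ a₁).toStage9Params)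
          (theta13OfThm1CCMW F 2 j γ ε₀ ε₂₉ B₃ B₃' a₀ a₁).ppSel P (gOfRecord₁₃ F 2 (theta13OfThm1CCMW F 2 j γ ε₀ ε₂₉ B₃ B₃' a₀ a₁) P) (lamW.kSel P + 1)) s →
      0 < ∫ V, rterm (reprTOfRecord₁₃ F 2 (theta13OfThm1CCMW F 2 j γ ε₀ ε₂₉ B₃ B₃' a₀ a₁) P (lamW.kSel P)) s V ∂(fieldMeasure (F.P P.K) (lamW.kSel P + 1) (SU 2)))
    (h12P1 : ∀ P : B12.RunParams, lamW.kSel P < P.K → Prop1Printed (lamW.LF P))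
    (h12i180 : ∀ P : B12.RunParams, lamW.kSel P < P.K → ∀ U, new189 (lamW.D189 P) U → ∀ i, (lamW.D189 P).h ≤ i → i ≤ (lamW.D189 P).k →
      ∀ q ∈ plaqsOf (dom (lamW.D189 P) i),
        Ineq180 ((lamW.D189 P).dev0 U q) ((lamW.D189 P).ε (lamW.D189 P).k) (lamW.D189 P).η (lamW.D189 P).B₃ (lamW.D189 P).B₅ (lamW.D189 P).M (lamW.D189 P).δ
          ((lamW.D189 P).dist q) (lamW.D189 P).O1)
    (h12c189 : ∀ P : B12.RunParams, lamW.kSel P < P.K → Claim189 (new189 (lamW.D189 P)) (chiPP (lamW.D189 P)))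
    (hsel : ∀ P : B12.RunParams, 1 ≤ P.K → lamW.kSel P < P.K) :
    ∃ lamW : ResidW F 2, (∀ P : B12.RunParams, lamW.kSel P < P.K → B15Leaf (WOfRecord₁₃ F 2 (theta13OfThm1CCMW F 2 j γ ε₀ ε₂₉ B₃ B₃' a₀ a₁) lamW P)) ∧
      ∀ P : B12.RunParams, 1 ≤ P.K → lamW.kSel P < P.K :=
  ⟨lamW, fun P hk => b15Leaf_WOfRecord₁₃_liveRepin₁₃_of_massLive_of_hasResiduals (theta13OfNumerics F 2 (stage12NumericsOfThm1CCMW F.L j γ ε₀ B₃ B₃' a₀ a₁) ε₂₉ (zeta316OfRecord F 2 (stage12NumericsOfThm1CCMW F.L j γ ε₀ B₃ B₃' a₀ a₁).ν (stage12NumericsOfThm1CCMW F.L j γ ε₀ B₃ B₃' a₀ a₁).τ9.M (stage12NumericsOfThm1CCMW F.L j γ ε₀ B₃ B₃' a₀ a₁).A₁) (RzOfRecord F 2) (ZtOfRecord F 2)) lamW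
    (hasResidualsOfRecord_theta13OfNumerics F 2 (stage12NumericsOfThm1CCMW F.L j γ ε₀ B₃ B₃' a₀ a₁) ε₂₉) hk (h12pin P hk) (h12mass P hk) (h12P1 P hk) (h12i180 P hk) (h12c189 P hk), hsel⟩

end PurePinRowBelow

section PurePinFamilyBelow
variable (lamW : ∀ (j : ℕ) (γ ε₀ ε₂₉ B₃ B₃' a₀ a₁ : ℝ), ResidW F 2)

/-- **★★ THE GUARDED FAMILY — dag-n24-c's `h12F` TYPE WITH ITS FIRST CONJUNCT READ BELOW THE TORUS (`lamW.kSel P < P.K →`), NOTHING ELSE CHANGED — FROM N12's RAW ROWS AS FAMILIES OVER THE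
WITNESS LETTERS ONLY** (the text proposed in ASK-1 for the mixed-pin engine variant's closers; none of the fifteen door letters is read; NO `hdeg`).  So on the mixed-pin road «what N12 owes
the K1⁷ closer» is, per witness, EXACTLY the five raw rows below the torus + `hsel` — the pure pin's off-torus residual is gone.  CONDITIONAL; nothing of Bałaban asserted; N12 NOT discharged;
K0⁷ ∕ K1⁷ NOT closed. [cite: Balaban1989LargeFieldI, (0.2)–(0.6) p.176, Prop. 1 (1.78) p.194, (1.80) p.195, (1.89) p.198, (1.99)–(1.102) pp.200–201; Balaban1988Convergent, (2.18) p.257, (3.16) p.268, (3.22)–(3.25) pp.269–270; Balaban1985Variational, Thm 1 (8)–(9) p.279; Balaban1987RG1, Thm 1 p.259, §1 p.264 (bookkeeping: the unread door letters)] -/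
theorem h12Fbelow_theta13OfThm1CCMW_of_massLive
    (h12pinF : ∀ (j : ℕ) (γ ε₀ ε₂₉ B₃ B₃' a₀ a₁ : ℝ), ∀ P : B12.RunParams, (lamW j γ ε₀ ε₂₉ B₃ B₃' a₀ a₁).kSel P < P.K → (lamW j γ ε₀ ε₂₉ B₃ B₃' a₀ a₁).D1100 P
      = rPrimeDataOfSel (reprTOfRecord₁₃ F 2 (theta13OfThm1CCMW F 2 j γ ε₀ ε₂₉ B₃ B₃' a₀ a₁) P ((lamW j γ ε₀ ε₂₉ B₃ B₃' a₀ a₁).kSel P))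
          ((theta13OfThm1CCMW F 2 j γ ε₀ ε₂₉ B₃ B₃' a₀ a₁).ppSel P (gOfRecord₁₃ F 2 (theta13OfThm1CCMW F 2 j γ ε₀ ε₂₉ B₃ B₃' a₀ a₁) P) ((lamW j γ ε₀ ε₂₉ B₃ B₃' a₀ a₁).kSel P + 1))
          (fibOfSeq F (theta13OfThm1CCMW F 2 j γ ε₀ ε₂₉ B₃ B₃' a₀ a₁).ν (theta13OfThm1CCMW F 2 j γ ε₀ ε₂₉ B₃ B₃' a₀ a₁).τ9 P (gOfRecord₁₃ F 2 (theta13OfThm1CCMW F 2 j γ ε₀ ε₂₉ B₃ B₃' a₀ a₁) P) ((lamW j γ ε₀ ε₂₉ B₃ B₃' a₀ a₁).kSel P + 1)))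
    (h12massF : ∀ (j : ℕ) (γ ε₀ ε₂₉ B₃ B₃' a₀ a₁ : ℝ), ∀ P : B12.RunParams, (lamW j γ ε₀ ε₂₉ B₃ B₃' a₀ a₁).kSel P < P.K → ∀ s, LiveSeq F 2 (theta13OfThm1CCMW F 2 j γ ε₀ ε₂₉ B₃ B₃' a₀ a₁).ν (theta13OfThm1CCMW F 2 j γ ε₀ ε₂₉ B₃ B₃' a₀ a₁).τ9 P (gOfRecord₁₃ F 2 (theta13OfThm1CCMW F 2 j γ ε₀ ε₂₉ B₃ B₃' a₀ a₁) P) ((lamW j γ ε₀ ε₂₉ B₃ B₃' a₀ a₁).kSel P + 1)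
        (slotsTOfRecord F 2 (theta13OfThm1CCMW F 2 j γ ε₀ ε₂₉ B₃ B₃' a₀ a₁).ν (theta13OfThm1CCMW F 2 j γ ε₀ ε₂₉ B₃ B₃' a₀ a₁).τ9 (EOfRecord₁₃ F 2 (theta13OfThm1CCMW F 2 j γ ε₀ ε₂₉ B₃ B₃' a₀ a₁)) (wOfRecord₉ F 2 (theta13OfThm1CCMW F 2 j γ ε₀ ε₂₉ B₃ B₃' a₀ a₁).toStage9Params)
          (theta13OfThm1CCMW F 2 j γ ε₀ ε₂₉ B₃ B₃' a₀ a₁).ppSel P (gOfRecord₁₃ F 2 (theta13OfThm1CCMW F 2 j γ ε₀ ε₂₉ B₃ B₃' a₀ a₁) P) ((lamW j γ ε₀ ε₂₉ B₃ B₃' a₀ a₁).kSel P + 1)) s →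
      0 < ∫ V, rterm (reprTOfRecord₁₃ F 2 (theta13OfThm1CCMW F 2 j γ ε₀ ε₂₉ B₃ B₃' a₀ a₁) P ((lamW j γ ε₀ ε₂₉ B₃ B₃' a₀ a₁).kSel P)) s V ∂(fieldMeasure (F.P P.K) ((lamW j γ ε₀ ε₂₉ B₃ B₃' a₀ a₁).kSel P + 1) (SU 2)))
    (h12P1F : ∀ (j : ℕ) (γ ε₀ ε₂₉ B₃ B₃' a₀ a₁ : ℝ), ∀ P : B12.RunParams, (lamW j γ ε₀ ε₂₉ B₃ B₃' a₀ a₁).kSel P < P.K → Prop1Printed ((lamW j γ ε₀ ε₂₉ B₃ B₃' a₀ a₁).LF P))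
    (h12i180F : ∀ (j : ℕ) (γ ε₀ ε₂₉ B₃ B₃' a₀ a₁ : ℝ), ∀ P : B12.RunParams, (lamW j γ ε₀ ε₂₉ B₃ B₃' a₀ a₁).kSel P < P.K → ∀ U, new189 ((lamW j γ ε₀ ε₂₉ B₃ B₃' a₀ a₁).D189 P) U → ∀ i, ((lamW j γ ε₀ ε₂₉ B₃ B₃' a₀ a₁).D189 P).h ≤ i → i ≤ ((lamW j γ ε₀ ε₂₉ B₃ B₃' a₀ a₁).D189 P).k →
      ∀ q ∈ plaqsOf (dom ((lamW j γ ε₀ ε₂₉ B₃ B₃' a₀ a₁).D189 P) i),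
        Ineq180 (((lamW j γ ε₀ ε₂₉ B₃ B₃' a₀ a₁).D189 P).dev0 U q) (((lamW j γ ε₀ ε₂₉ B₃ B₃' a₀ a₁).D189 P).ε ((lamW j γ ε₀ ε₂₉ B₃ B₃' a₀ a₁).D189 P).k) ((lamW j γ ε₀ ε₂₉ B₃ B₃' a₀ a₁).D189 P).η ((lamW j γ ε₀ ε₂₉ B₃ B₃' a₀ a₁).D189 P).B₃ ((lamW j γ ε₀ ε₂₉ B₃ B₃' a₀ a₁).D189 P).B₅ ((lamW j γ ε₀ ε₂₉ B₃ B₃' a₀ a₁).D189 P).M ((lamW j γ ε₀ ε₂₉ B₃ B₃' a₀ a₁).D189 P).δ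
          (((lamW j γ ε₀ ε₂₉ B₃ B₃' a₀ a₁).D189 P).dist q) ((lamW j γ ε₀ ε₂₉ B₃ B₃' a₀ a₁).D189 P).O1)
    (h12c189F : ∀ (j : ℕ) (γ ε₀ ε₂₉ B₃ B₃' a₀ a₁ : ℝ), ∀ P : B12.RunParams, (lamW j γ ε₀ ε₂₉ B₃ B₃' a₀ a₁).kSel P < P.K → Claim189 (new189 ((lamW j γ ε₀ ε₂₉ B₃ B₃' a₀ a₁).D189 P)) (chiPP ((lamW j γ ε₀ ε₂₉ B₃ B₃' a₀ a₁).D189 P)))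
    (hselF : ∀ (j : ℕ) (γ ε₀ ε₂₉ B₃ B₃' a₀ a₁ : ℝ), ∀ P : B12.RunParams, 1 ≤ P.K → (lamW j γ ε₀ ε₂₉ B₃ B₃' a₀ a₁).kSel P < P.K) :
    ∀ {j c : ℕ} {γ ε₀ ε₂₉ B₃ B₃' a₀ a₁ : ℝ} (hγ₀ : 0 < γ) (hγh : γ ≤ 1 / 2) (hε : 0 < ε₀) (hε' : 0 < ε₂₉) (hB : 0 ≤ B₃) (hB' : 0 ≤ B₃') (ha₀ : 0 < a₀) (ha₁ : 0 < a₁) (h15 : VariationalThm1RegSepCoP7M F 2 B₃ a₀ a₁) (hc : c ≤ F.L ^ j) (h9 : Gauge9RegSepTopStepR F 2 (fun ν K Ω => suppDomOfRecord F ν K Ω) (F.L ^ j) c B₃ B₃' a₀ a₁) {bl β' : ℝ} (hbox : BetaLowerH bl γ (betaOfRecord₁₃ F 2 (theta13OfThm1CCMW F 2 j γ ε₀ ε₂₉ B₃ B₃' a₀ a₁))) (hbox' : BetaUpperH β' γ (betaOfRecord₁₃ F 2 (theta13OfThm1CCMW F 2 j γ ε₀ ε₂₉ B₃ B₃' a₀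 a₁))) (hl : -bl * γ ^ 2 ≤ 3) (hβ' : β' * γ ^ 2 ≤ 3 / 4),
      ∃ lamW : ResidW F 2, (∀ P : B12.RunParams, lamW.kSel P < P.K → B15Leaf (WOfRecord₁₃ F 2 (theta13OfThm1CCMW F 2 j γ ε₀ ε₂₉ B₃ B₃' a₀ a₁) lamW P)) ∧
      ∀ P : B12.RunParams, 1 ≤ P.K → lamW.kSel P < P.K :=
  by
  intro j _ γ ε₀ ε₂₉ B₃ B₃' a₀ a₁ _ _ _ _ _ _ _ _ _ _ _ _ _ _ _ _ _
  exact exists_residW_b15Leaf_below_theta13OfThm1CCMW_of_massLive (lamW j γ ε₀ ε₂₉ B₃ B₃' a₀ a₁)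
    (h12pinF j γ ε₀ ε₂₉ B₃ B₃' a₀ a₁) (h12massF j γ ε₀ ε₂₉ B₃ B₃' a₀ a₁) (h12P1F j γ ε₀ ε₂₉ B₃ B₃' a₀ a₁) (h12i180F j γ ε₀ ε₂₉ B₃ B₃' a₀ a₁)
    (h12c189F j γ ε₀ ε₂₉ B₃ B₃' a₀ a₁) (hselF j γ ε₀ ε₂₉ B₃ B₃' a₀ a₁)

end PurePinFamilyBelow

end Summit.QuantumFields.YangMills.BalabanUVNodes.N12AtTheta13OfThm1CCMWGenericDoorV19
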